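import Summits.QuantumFields.YangMills.Theorems.BalabanUVNodesK0Stub1CriticalEquation143CoordFree
import Summits.QuantumFields.YangMills.Theorems.UnitScaleTiltProp8FlatCubeOperators
import Literature.MathematicalPhysics.QuantumFieldTheory.Balaban1983to89.T4Continuum
import HarnessLib

/-!
# K0⁷ STUB 1 (`stub_prop8StepCoP13`), sub-target S4a file 5: **[15] (127) ⟹ (158) WITH PRINT's EXPLICIT MULTI-LEVEL FLAT OPERATORS `H = GQ*(QGQ*)⁻¹` ((45)∕(157))
# AND `G̃ = G − HQG` ((143)∕(158)) OF AN ARBITRARY NESTED DOMAIN FAMILY — in particular the cube sequence (144) — ON THE SETUP TORUS, AND AT THE RECORD's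
# FINE TORUS `Site (F.P K) 0`**: this seat's coordinate-free derivation (`…K0Stub1CriticalEquation143CoordFree`, F4 part 5 transferred) COMPOSED with UST's
# pillar F3′ `FlatCubeOperators` (print's `H`, `G̃` for every `D : Domains P`, exact algebra) and lit-balaban's positivity of `Δ_a` ([B6] (2.19)–(2.22))

Cell `pub-ymgap`, width seat `pub-ymgap-k0-s1-w1` g0 (plan g77 W-SEAT-START-LIST v3 §k0-s1, S4a «transfer UST `FlatCriticalEquation143` + … to the record's objects»).
`--kind proof --supports stmt-QuantumFields-20541 --as helper`; count-neutral.  [15] = [Balaban1985Variational]; [B6] = [Balaban1984PropagatorsII].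

WHY.  File 2 of this seat derives (127) ⟹ (128) ⟹ (143) ⟹ (158) over any finite-dimensional real inner-product space from four hypotheses on the operators:
`hpos` (Δ_a positive on `ker Q`), `hG` (`G̃` takes values in `ker Q` and inverts `Δ_a` weakly there), `hQH` (`QH = 1`), `hHorth` (`⟨δ, Δ_a HB⟩ = 0` on `ker Q`).
For the FLAT multi-level operators these four are THEOREMS of the tree for EVERY nested family `D : B6SectADomainsV1.Domains P` on the Setup torus
(`BondSpace P = EuclideanSpace ℝ (PBond P 0)`, `Δ_a = B6SectAVectorModelV1.deltaAE D c w` = [B6] (2.19), `Q = B6SectAOperatorsV1.QE D` = the multi-level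
constraints (2.20) = [15] (156)–(157) «L^jηQ_jA′ = B on Λ′_j, j = 0, …, k»): positivity is lit-balaban's `inner_deltaAE_self_nonneg` +
`eq_zero_of_inner_deltaAE_self_eq_zero`; `H := hOp (GE D) (QsE D) (EE D)` and `G̃ := GE D − H ∘ QE D ∘ GE D` are UST `FlatCubeOperators`' explicit operators with
`QE_hOp` (= `hQH`), `inner_deltaAE_hOp_eq_zero` (= `hHorth`), `QE_Gt` + `inner_deltaAE_Gt_of_ker` (= `hG`).  THIS FILE performs the composition: for every
nested family (the cube sequence (144) of Sect. F = UST `FlatCubeSequence.cubeSeq(M)`, the one-level family, …), every `A′` critical in the sense (128) has its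
tangent component `A₁ = A′ − H(QA′)` solving *«A₁ + G̃((δ∕δA′)V)(A₁ + HB) = 0. (158)»* with PRINT's `H` and `G̃` — and file 2's abstract restricted
solution operator IS print's `G̃` (uniqueness).  At the record: `P := F.P K` of a `T4Family` member (`_T4` corollary).  File 4 of this seat
(`…FlatPropagatorsExistAtRecord`) keeps its separate content: the `k`-UNIFORM `L²` letters from [B5] (1.90) at one level; existence of `G`, `G̃` per se is
UST∕lit-balaban's (this header says so explicitly; file 4's §2–§3 are the lettered one-level instances).

WHAT IS PROVED (sorry-free; no definition; axioms standard; every `P : Params`, `D : Domains P`, lattice factor `c ≠ 0`, weights `w > 0`).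
* §1 `deltaAE_pos_of_ne_zero` (`x ≠ 0 ⇒ 0 < ⟨x, Δ_a x⟩`, lit-balaban positivity repackaged as file 2's `hpos` on any subspace).
* §2 ★ `eq158_of_critical128_flatOps` — (127)∕(128) ⟹ (158) with print's explicit `H`, `G̃` of the family `D`, ANY map `W` (print `(δ∕δA′)V`);
  `eq143_of_critical128_flatOps` (`A′ − H(QA′) = −G̃w`); `restrictedSolutionOp_eq_flatGt` (file 2's abstract `G̃` on `ker Q` = print's `G − HQG`).
* §3 `eq158_of_critical128_flatOps_T4` — the record's fine torus `Site (F.P K) 0` (`F : T4Family`), any nested family there.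
HONEST SCOPE.  FLAT background; exact algebra — no letter∕estimate ([B6] Props. 2.2–2.7 ∕ Cor. 2.8 at d = 4 = the port bridge; Prop. 4's `(δ∕δA′)V`; the sizes
(115)); the passage from curve-criticality on the multi-scale fibre to (127) on `ker Q` (S2's chart + 35a) is NOT here; which `D` realises Sect. F's collared cube
at the record (S3, k0-s1-w3 LOCATED-S5-1 on the support geometry) is NOT decided here.  Nothing of [15]'s analysis asserted; `stub_prop8StepCoP13` ∕ K0⁷ NOT closed;
N07 NOT discharged; counts unmoved (28∕28 · 5∕27); one finite 𝕋⁴ programme at fixed ε — R4 closes the conditional finite-𝕋⁴ rung `BalabanLadder.UV` only, never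
the summit; the YM mass gap (Clay) is NOT proved by any of this; nothing continuum ∕ ℝ⁴ ∕ OS.  No `sorry`, no `def`, no `instance`, no `notation`.

References: [15] (45)–(46) p.285, (127)–(133) pp.297–298, (143) p.300, (156)–(158) p.302; [B6] (2.19)–(2.22) p.226, (2.34)–(2.35) p.228.
-/

set_option autoImplicit false

noncomputable section

open scoped InnerProductSpace RealInnerProductSpace

namespace Summit.QuantumFields.YangMills.Theorems.K0Stub1Eq158FlatOpsAtRecord

open Literature.MathematicalPhysics.QuantumFieldTheory.Balaban1983to89
open Literature.MathematicalPhysics.QuantumFieldTheory.Balaban1983to89.T4Continuum (T4Family)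
open Literature.MathematicalPhysics.QuantumFieldTheory.BalabanImbrieJaffe1984to88.BIJ85AxialPropagator411 (BondSpace)
open B6SectADomainsV1 (Domains)
open B6SectAOperatorsV1 (BondIdx BondIdxSpace QE QsE)
open B6SectAVectorModelV1 (deltaAE GE EE inner_deltaAE_self_nonneg eq_zero_of_inner_deltaAE_self_eq_zero)
open B6SectA (hOp)
open Summit.QuantumFields.YangMills.Theorems.FlatCubeOperators (QE_hOp inner_deltaAE_hOp_eq_zero QE_Gt inner_deltaAE_Gt_of_ker)
open Summit.QuantumFields.YangMills.Theorems.K0Stub1CriticalEquation143CoordFree (exists_restrictedSolutionOp eq143_of_critical128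
  eq158_of_critical128)

variable {P : Params} (D : Domains P) {c : ℝ} {w : BondIdx D → ℝ}

/-! ## §1  `Δ_a` of every nested family is positive definite (lit-balaban), as file 2's `hpos` -/

/-- **`x ≠ 0 ⇒ 0 < ⟨x, Δ_a x⟩`** for the flat multi-level operator `Δ_a = ∂*∂ + ∂R∂* + Q*aQ` ([B6] (2.19)) of ANY nested family `D` (`c ≠ 0`, weights `> 0`):
lit-balaban's `inner_deltaAE_self_nonneg` and `eq_zero_of_inner_deltaAE_self_eq_zero` ((2.19)–(2.22): «The only assumption we have used was the positivity of
the operator Δ_a»). [cite: Balaban1984PropagatorsII, (2.19)–(2.22) p.226] -/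
theorem deltaAE_pos_of_ne_zero (hc : c ≠ 0) (hw : ∀ i, 0 < w i) (x : BondSpace P) (hx : x ≠ 0) : 0 < ⟪x, deltaAE D c w x⟫_ℝ := by
  refine lt_of_le_of_ne (inner_deltaAE_self_nonneg D c (fun i => (hw i).le) x) fun h => hx ?_
  exact eq_zero_of_inner_deltaAE_self_eq_zero D hc hw h.symm

/-! ## §2  ★ (127)∕(128) ⟹ (158) with print's explicit `H` and `G̃` of the family -/

/-- ★ **[15] (128) ⟹ (133)∕(143) WITH PRINT's OPERATORS**: for every nested family `D`, every `w ∈ BondSpace P` and every `A′` with `⟨δ, Δ_aA′ + w⟩ = 0` for all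
`δ ∈ ker Q` (`Q = QE D`, the multi-level constraints (156)–(157)), the tangent component satisfies `A′ − H(QA′) = −G̃w` with `H = GQ*(QGQ*)⁻¹` ((45)∕(129)∕(157),
UST `hOp (GE D) (QsE D) (EE D)`) and `G̃ = G − HQG` ((143)∕(158)).  File 2's `eq143_of_critical128` with `hpos`∕`hG`∕`hQH`∕`hHorth` supplied by lit-balaban ∕ UST
`FlatCubeOperators`. [cite: Balaban1985Variational, (129)–(133) pp.297–298, (143) p.300; Balaban1984PropagatorsII, (2.35) p.228] -/
theorem eq143_of_critical128_flatOps (hc : c ≠ 0) (hw : ∀ i, 0 < w i) {A' v : BondSpace P}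
    (h128 : ∀ δ ∈ LinearMap.ker (QE D), ⟪δ, deltaAE D c w A' + v⟫_ℝ = 0) :
    A' - hOp (GE D hc hw) (QsE D) (EE D hc hw) (QE D A') =
      -((GE D hc hw - hOp (GE D hc hw) (QsE D) (EE D hc hw) ∘ₗ QE D ∘ₗ GE D hc hw) v) :=
  eq143_of_critical128 (deltaAE D c w) (QE D) (fun z _ hz => deltaAE_pos_of_ne_zero D hc hw z hz)
    (GE D hc hw - hOp (GE D hc hw) (QsE D) (EE D hc hw) ∘ₗ QE D ∘ₗ GE D hc hw)
    (fun f => ⟨LinearMap.mem_ker.2 (QE_Gt D hc hw f), fun _ hδ => inner_deltaAE_Gt_of_ker D hc hw (LinearMap.mem_ker.1 hδ) f⟩)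
    (hOp (GE D hc hw) (QsE D) (EE D hc hw)) (QE_hOp D hc hw) (fun _ hδ B => inner_deltaAE_hOp_eq_zero D hc hw (LinearMap.mem_ker.1 hδ) B) h128

/-- ★★ **[15] (127)∕(128) ⟹ (158) WITH PRINT's EXPLICIT MULTI-LEVEL FLAT OPERATORS, FOR EVERY NESTED DOMAIN FAMILY** (the cube sequence (144), the one-level
family, …): if `A′` is critical in the sense (128) — `⟨δ, Δ_aA′ + W(A′)⟩ = 0` for all `δ ∈ ker Q`, ANY map `W` (print: `(δ∕δA′)V` at background `1`, `J = 0`) —,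
then with `B := QA′`, `HB = hOp (GE D) (QsE D) (EE D) B` (print's `H`, (45): `Q(HB) = B`, `R∂*(HB) = 0`) and `A₁ := A′ − HB`:
*«A₁ + G̃((δ∕δA′)V)(A₁ + HB) = 0. (158)»* with `G̃ = G − HQG` — the equation of [15] Prop. 6 ∕ file 1 of this seat, now with the operators OF RECORD for the
family `D`. [cite: Balaban1985Variational, (127)–(128) p.297, (143) p.300, (157)–(158) p.302; Balaban1984PropagatorsII, (2.19) p.226, (2.35) p.228] -/
theorem eq158_of_critical128_flatOps (hc : c ≠ 0) (hw : ∀ i, 0 < w i) (W : BondSpace P → BondSpace P) {A' : BondSpace P}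
    (h128 : ∀ δ ∈ LinearMap.ker (QE D), ⟪δ, deltaAE D c w A' + W A'⟫_ℝ = 0) :
    (A' - hOp (GE D hc hw) (QsE D) (EE D hc hw) (QE D A')) +
        (GE D hc hw - hOp (GE D hc hw) (QsE D) (EE D hc hw) ∘ₗ QE D ∘ₗ GE D hc hw)
          (W ((A' - hOp (GE D hc hw) (QsE D) (EE D hc hw) (QE D A')) + hOp (GE D hc hw) (QsE D) (EE D hc hw) (QE D A'))) = 0 :=
  eq158_of_critical128 (deltaAE D c w) (QE D) (fun z _ hz => deltaAE_pos_of_ne_zero D hc hw z hz)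
    (GE D hc hw - hOp (GE D hc hw) (QsE D) (EE D hc hw) ∘ₗ QE D ∘ₗ GE D hc hw)
    (fun f => ⟨LinearMap.mem_ker.2 (QE_Gt D hc hw f), fun _ hδ => inner_deltaAE_Gt_of_ker D hc hw (LinearMap.mem_ker.1 hδ) f⟩)
    (hOp (GE D hc hw) (QsE D) (EE D hc hw)) (QE_hOp D hc hw) (fun _ hδ B => inner_deltaAE_hOp_eq_zero D hc hw (LinearMap.mem_ker.1 hδ) B) W h128

/-- **FILE 2's ABSTRACT RESTRICTED SOLUTION OPERATOR ON `ker Q` IS PRINT's `G̃ = G − HQG`**: every ℝ-linear `G'` with values in `ker Q` and `⟨δ, Δ_a(G'v)⟩ = ⟨δ, v⟩`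
on `ker Q` (the intrinsic characterisation of file 2's `exists_restrictedSolutionOp`) coincides with UST's explicit `G̃` — uniqueness of the restricted solution
(`FlatCubeOperators.eq_Gt_of_ker`'s content, here via file 2's `restricted_solution_unique`). [cite: Balaban1985Variational, (131) p.298, (143) p.300 («GP₀* = G̃»)] -/
theorem restrictedSolutionOp_eq_flatGt (hc : c ≠ 0) (hw : ∀ i, 0 < w i) (G' : BondSpace P →ₗ[ℝ] BondSpace P)
    (hG' : ∀ v, G' v ∈ LinearMap.ker (QE D) ∧ ∀ δ ∈ LinearMap.ker (QE D), ⟪δ, deltaAE D c w (G' v)⟫_ℝ = ⟪δ, v⟫_ℝ) (v : BondSpace P) :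
    G' v = (GE D hc hw - hOp (GE D hc hw) (QsE D) (EE D hc hw) ∘ₗ QE D ∘ₗ GE D hc hw) v :=
  K0Stub1CriticalEquation143CoordFree.restricted_solution_unique (LinearMap.ker (QE D)) (deltaAE D c w)
    (fun z _ hz => deltaAE_pos_of_ne_zero D hc hw z hz) (hG' v).1 (LinearMap.mem_ker.2 (QE_Gt D hc hw v))
    fun δ hδ => by rw [(hG' v).2 δ hδ, inner_deltaAE_Gt_of_ker D hc hw (LinearMap.mem_ker.1 hδ) v]

/-! ## §3  At the record's fine torus -/

/-- **(127)∕(128) ⟹ (158) WITH PRINT's OPERATORS AT THE RECORD's FINE TORUS** (`P := F.P K` of a 𝕋⁴-family member; `D` any nested domain family on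
`Site (F.P K) 0` — the cube sequence (144) of Sect. F at the record once S3 names it, or UST `FlatCubeSequence.cubeSeqM` at `F.P K`):
`eq158_of_critical128_flatOps` read at the record. [cite: Balaban1985Variational, (157)–(158) p.302; Balaban1987RG1, (0.1) p.251] -/
theorem eq158_of_critical128_flatOps_T4 (F : T4Family) (K : ℕ) (D : Domains (F.P K)) {c : ℝ} (hc : c ≠ 0) {w : BondIdx D → ℝ}
    (hw : ∀ i, 0 < w i) (W : BondSpace (F.P K) → BondSpace (F.P K)) {A' : BondSpace (F.P K)}
    (h128 : ∀ δ ∈ LinearMap.ker (QE D), ⟪δ, deltaAE D c w A' + W A'⟫_ℝ = 0) :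
    (A' - hOp (GE D hc hw) (QsE D) (EE D hc hw) (QE D A')) +
        (GE D hc hw - hOp (GE D hc hw) (QsE D) (EE D hc hw) ∘ₗ QE D ∘ₗ GE D hc hw)
          (W ((A' - hOp (GE D hc hw) (QsE D) (EE D hc hw) (QE D A')) + hOp (GE D hc hw) (QsE D) (EE D hc hw) (QE D A'))) = 0 :=
  eq158_of_critical128_flatOps D hc hw W h128

end Summit.QuantumFields.YangMills.Theorems.K0Stub1Eq158FlatOpsAtRecord

end
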